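import Mathlib
import Literature.Probability.LatticeModels.CornerFugacityMeasure
import Literature.Probability.LatticeModels.CellGridSaddlePercolation
import Literature.Probability.Percolation.Crossings
import Literature.Probability.Percolation.Percolation
import Literature.Probability.Percolation.CardyFormula

/-!
# Sketch — crux-ideate stmt-CriticalPhenomena-10964 (CornerLineDescent), ideator 1, round 1

First lemmas of the two idea cards, stated over existing declarations (no new Literature
objects).  `sorry` marks statements that are to be proved by the line, not here.

* Card `symmetric-seed-second-order`: `zeroAmplitude_square` — under the free self-dual
  corner-fugacity measure `M(t, ½)` on a square of cells centred at a grid VERTEX `f`, the black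
  left–right crossing and the corner bit `κ_f` are exactly uncorrelated (the crossing probability
  is `½` also after tilting by `κ_f`), for every `t`.  This is the lattice form of "the corner
  seed has zero four-arm amplitude": the symmetry `ι = (colour flip ∘ coin flip ∘ quarter turn
  about f)` preserves the measure and `{κ_f = 1}` and maps the crossing to the complement of the
  crossing (Hex lemma `cellCrossing_duality`, taken as a hypothesis as in the tree).
* Card `dislocation-gas-endgame`: `blk_toggle` — in the explicit i.i.d. gauge of the route
  (`blk ω v = A_{v0} ⊕ B_{v1} ⊕ parity of defects in the rectangle between 0 and v`), toggling ONE
  defect bit at the vertex `f` flips the colour of exactly the cells `v` whose defect rectangle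
  contains `f` — a quadrant with apex `f`; i.e. one corner = one quadrant recolouring = one
  lattice dislocation of the black graph.  `RegimeOne` types the short-scale half of the
  two-scale endgame (defect density `p ≤ c δ`: the crude crossing probabilities of the gauge model
  with parameter `p` and with `p = 0` differ by at most `ε`, eventually in `δ`).
-/

noncomputable section

open MeasureTheory Classical
open scoped NNReal

namespace Summit.CriticalPhenomena.CardyFormulaZ2.Cruxes.CornerLineDescent.IdeatorOne

open Literature.Probability.LatticeModels Literature.Probability.Percolation

/-! ### Card A: zero four-arm amplitude of the corner seed (exact, every `t`) -/

/-- **Zero amplitude on the centred square.** For the free corner-fugacity measure `M(t, ½)` on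
the square of cells `rectangle (2k+1) (2k+1) = {0,…,2k+1}²`, whose centre is the grid vertex
`f = (k, k)` (cells `(k,k), (k+1,k), (k,k+1), (k+1,k+1)` around it), the black left–right crossing
`cellLRCrossing` and the event "`f` is an odd face (corner)" satisfy
`P(LR ∩ {κ_f}) = P({κ_f}) / 2`, i.e. `Cov_t(1_LR, κ_f) = 0` (since `P(LR) = ½`).  Proof intended:
`ι := swap ∘ flipCoins ∘ (rotation x ↦ (2k+1 - x₁, x₀))` preserves `freeCornerFugacityMeasure t ½ Λ`
(`freeCornerFugacityMeasure_map_relabel`, `cornerGibbsMeasure_map_flip`,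
`freeCornerFugacityMeasure_map_flipCoins`), fixes `{IsOddFace · f}` (`isOddFace_flip_iff`,
`isOddFace_relabel_iff`) and maps `cellLRCrossing` onto the white top–bottom crossing, which is
the complement of `cellLRCrossing` by the Hex lemma `hdual`. [provable now, size M] -/
theorem zeroAmplitude_square (hdual : cellCrossing_duality) (t : ℝ≥0) (k : ℕ) :
    (freeCornerFugacityMeasure t half (rectangle (2 * k + 1) (2 * k + 1))).real
        (cellLRCrossing (2 * k + 1) (2 * k + 1) ∩ {ω | IsOddFace ω.1 ![(k : ℤ), (k : ℤ)]}) =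
      (freeCornerFugacityMeasure t half (rectangle (2 * k + 1) (2 * k + 1))).real
        {ω | IsOddFace ω.1 ![(k : ℤ), (k : ℤ)]} / 2 := by
  sorry

/-- The same statement in covariance form: `E[1_LR · 1_{κ_f}] - E[1_LR] E[1_{κ_f}] = 0` on the
centred square, using `P(LR) = ½` (self-duality + quarter-turn symmetry). [provable now] -/
theorem cov_crossing_corner_centre_eq_zero (hdual : cellCrossing_duality) (t : ℝ≥0) (k : ℕ) :
    let μ := freeCornerFugacityMeasure t half (rectangle (2 * k + 1) (2 * k + 1))
    μ.real (cellLRCrossing (2 * k + 1) (2 * k + 1) ∩ {ω | IsOddFace ω.1 ![(k : ℤ), (k : ℤ)]}) -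
        μ.real (cellLRCrossing (2 * k + 1) (2 * k + 1)) *
          μ.real {ω | IsOddFace ω.1 ![(k : ℤ), (k : ℤ)]} = 0 := by
  sorry

/-! ### Card B: one corner = one quadrant flip = one dislocation (explicit gauge) -/

/-- The colour of cell `v` in the explicit i.i.d. gauge of the route file (line bits `A`, `B`,
defect set `C`): `A_{v 0} ⊕ B_{v 1} ⊕ (parity of the defects in the rectangle spanned by 0 and v)`.
Verbatim the `blk` of `CardyIKTransport.CornerLineDescent` with `par ω f := f ∈ C`. -/
def blk (A B : Set ℤ) (C : Set (Site 2)) (v : Site 2) : Prop :=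
  Xor (v 0 ∈ A) (Xor (v 1 ∈ B)
    (Odd ((Finset.filter (fun f : ℤ × ℤ => (![f.1, f.2] : Site 2) ∈ C)
      (Finset.Ico (min 0 (v 0)) (max 0 (v 0)) ×ˢ Finset.Ico (min 0 (v 1)) (max 0 (v 1)))).card)))

/-- The defect rectangle of `v` (vertices strictly between `0` and `v` in the gauge's half-open
convention). -/
def defectRect (v : Site 2) : Finset (ℤ × ℤ) :=
  Finset.Ico (min 0 (v 0)) (max 0 (v 0)) ×ˢ Finset.Ico (min 0 (v 1)) (max 0 (v 1))

/-- **One corner = one quadrant recolouring.** Toggling the single defect bit at `f` changes the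
colour of `v` iff `f` lies in the defect rectangle of `v`; for fixed `f` the set of such `v` is a
quadrant with apex at `f` (pointing away from the origin), so in the black graph (cells + one
coin-chosen diagonal per face) the toggle is a lattice dislocation with core `f` and Burgers
vector `(±1, ±1)`: every other vertex keeps its odd/even (corner) status. [provable now, finite
combinatorics: `filter (· ∈ C ∆ {f}) R = filter (· ∈ C) R ∆ filter (· = f) R` and parity of
`card` is additive under `∆`] -/
theorem blk_toggle (A B : Set ℤ) (C : Set (Site 2)) (f v : Site 2) :
    blk A B (symmDiff C {f}) v ↔ Xor (blk A B C v) ((f 0, f 1) ∈ defectRect v) := by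
  sorry

/-- The crude crossing probability of the gauge model with defect density `p` (the route's `P_IK`
is the case `p = 2√3 - 3`; `p = 0` is bond-`ℤ²` at `½` on the renewal grid, FreezeIdentification):
five-fold product measure, colours `blk`, fair anti-diagonal coins, crude event
`embDomainCrossing` on the standard cell positions `v ↦ v0 + i v1`. -/
def gaugeCrossingProb (p : ℝ) (R : Literature.Probability.RandomPlanarGeometry.ConformalRectangle)
    (δ : ℝ) : ℝ :=
  let μ := (sitePercolation ℤ half).prod ((sitePercolation ℤ half).prod
    ((sitePercolation (Site 2) (Set.projIcc (0:ℝ) 1 zero_le_one p)).prod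
      (sitePercolation (Site 2) half)))
  let edges : (Set ℤ × (Set ℤ × (Set (Site 2) × Set (Site 2)))) → BondConfig (Site 2) :=
    fun ω => {e | ∃ u v, e = s(u, v) ∧ blk ω.1 ω.2.1 ω.2.2.1 u ∧ blk ω.1 ω.2.1 ω.2.2.1 v ∧
      (v = u + ![1, 0] ∨ v = u + ![0, 1] ∨ (v = u + ![1, 1] ∧ u ∉ ω.2.2.2) ∨
        (v = u + ![1, -1] ∧ (u + ![0, -1]) ∈ ω.2.2.2))}
  μ.real {ω | edges ω ∈ embDomainCrossing
    (fun v : Site 2 => ((v 0 : ℝ) : ℂ) + ((v 1 : ℝ) : ℂ) * Complex.I) R.carrier δ (R.arc 0) (R.arc 2)}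

/-- **Regime I of the two-scale endgame (typed).** Below the first crossover scale the dislocation
gas is absorbed by bond-`ℤ²`'s own toolbox: for every conformal rectangle `R` and `ε > 0` there
is, FOR EVERY window constant `c > 0`, eventually as `δ → 0⁺`, the bound: every defect
density `p ≤ c δ` changes the crude crossing probability by at most `ε` relative to `p = 0`
(renewal-grid bond-`ℤ²`).  At `p ≤ c δ` the colour correlation length `ξ ≍ 1/p ≥ (c δ)⁻¹` is
macroscopic, so the model is bond-`ℤ²` with `≍ c δ⁻¹` dislocations, `O(c)` per grid line.
Intended proof: Russo in `p` (product measure) + `blk_toggle` (one defect = one dislocation,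
core-local in law up to the half-plane gauge symmetries) + union bound with bond-`ℤ²`'s four-arm
bound `π₄(δ, 1) ≤ δ^{1 + c₄}` (`α₄ > 1`, equivalently Kesten's `ν > 1`; Nolin 2008 §8.1, Kesten
1987) transported to renewal grids carrying `O(c)` dislocations per line (RSW for locally
perturbed `ℤ²`): `|P_p - P_0| ≤ p δ⁻² · C δ^{1+c₄} ≤ C c δ^{c₄} → 0`. [open, size L] -/
def RegimeOne : Prop :=
  ∀ (R : Literature.Probability.RandomPlanarGeometry.ConformalRectangle) (ε : ℝ), 0 < ε →
    ∀ c : ℝ, 0 < c → ∀ᶠ δ in nhdsWithin (0 : ℝ) (Set.Ioi 0), ∀ p : ℝ, 0 ≤ p → p ≤ c * δ →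
      |gaugeCrossingProb p R δ - gaugeCrossingProb 0 R δ| ≤ ε

/-- **Uniform corner irrelevance in units of the colour correlation length (Card A's output, the
other half of the endgame).**  `ξ_t ≍ 1/t`: there are `θ > 0`, `C` and `c > 0` with
`|t ∂_t P_t(R, δ)| ≤ C (δ / t)^θ` for `c δ ≤ t ≤ √3/2`; integrating `dt/t` over that range gives
`|P_{√3/2}(R,δ) - P_{cδ}(R,δ)| ≤ C θ⁻¹ c^{-θ}` — so the statement is typed directly in integrated
form with a rate: for all `δ` small and all `t ∈ [c δ, √3/2]`,
`|P_{√3/2}(R, δ) - P_t(R, δ)| ≤ C (δ / t)^θ`, with `P_t := gaugeCrossingProb (t/(1+t))`. -/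
def UniformCornerIrrelevance : Prop :=
  ∀ (R : Literature.Probability.RandomPlanarGeometry.ConformalRectangle),
    ∃ θ C c : ℝ, 0 < θ ∧ 0 < c ∧ ∀ᶠ δ in nhdsWithin (0 : ℝ) (Set.Ioi 0), ∀ t : ℝ,
      c * δ ≤ t → t ≤ Real.sqrt 3 / 2 →
        |gaugeCrossingProb ((Real.sqrt 3 / 2) / (1 + Real.sqrt 3 / 2)) R δ -
            gaugeCrossingProb (t / (1 + t)) R δ| ≤ C * (δ / t) ^ θ

/-- **Endgame assembly (logic only, provable now):** Regime I + uniform irrelevance in units of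
`ξ_t` give that the isotropic-IK gauge model and the renewal-grid bond model (`p = 0`) have the
same crude crossing limits: given `ε`, take `θ, C, c₀` from `h2`, a window constant
`K ≥ c₀` with `C K^{-θ} ≤ ε/2`, and apply `h1` with `ε/2` and `c := K` at `p = Kδ/(1+Kδ) ≤ K δ`;
the two regimes OVERLAP at `t = K δ`.  With the crux's hypothesis (Cardy for `P_IK`, which is
`gaugeCrossingProb (2√3-3)` since `(√3/2)/(1+√3/2) = 2√3-3`) and the in-law form of
`RenewalGridHarmless` this is `CornerLineDescent`.  Stated here as the limit-transfer core. -/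
theorem endgame_core (h1 : RegimeOne) (h2 : UniformCornerIrrelevance)
    (R : Literature.Probability.RandomPlanarGeometry.ConformalRectangle) (ε : ℝ) (hε : 0 < ε) :
    ∀ᶠ δ in nhdsWithin (0 : ℝ) (Set.Ioi 0),
      |gaugeCrossingProb ((Real.sqrt 3 / 2) / (1 + Real.sqrt 3 / 2)) R δ -
          gaugeCrossingProb 0 R δ| ≤ ε := by
  obtain ⟨θ, C, c₀, hθ, hc₀, hev2⟩ := h2 R
  -- window constant K: large enough that C K^{-θ} ≤ ε / 2, and at least c₀
  set M : ℝ := max (2 * C / ε) 1 with hM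
  have hM1 : 1 ≤ M := le_max_right _ _
  have hMpos : 0 < M := lt_of_lt_of_le one_pos hM1
  set K₁ : ℝ := M ^ (1 / θ) with hK₁
  have hK₁pos : 0 < K₁ := Real.rpow_pos_of_pos hMpos _
  set K : ℝ := max c₀ K₁ with hK
  have hKpos : 0 < K := lt_of_lt_of_le hc₀ (le_max_left _ _)
  have hK₁le : K₁ ≤ K := le_max_right _ _
  have hc₀le : c₀ ≤ K := le_max_left _ _
  -- (1/K)^θ ≤ (1/K₁)^θ = 1/M ≤ ε/(2C) when C > 0
  have hKθ : (1 / K) ^ θ ≤ 1 / M := by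
    have h1 : (1 / K) ^ θ ≤ (1 / K₁) ^ θ := by
      apply Real.rpow_le_rpow (by positivity)
      · exact one_div_le_one_div_of_le hK₁pos hK₁le
      · exact hθ.le
    have h2' : (1 / K₁) ^ θ = 1 / M := by
      rw [Real.div_rpow zero_le_one hK₁pos.le, Real.one_rpow, hK₁, ← Real.rpow_mul hMpos.le,
        one_div_mul_cancel hθ.ne', Real.rpow_one]
    exact h1.trans h2'.le
  have hCK : C * (1 / K) ^ θ ≤ ε / 2 := by
    by_cases hC : C ≤ 0
    · have : 0 ≤ (1 / K) ^ θ := by positivity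
      have : C * (1 / K) ^ θ ≤ 0 := mul_nonpos_of_nonpos_of_nonneg hC this
      linarith
    · push Not at hC
      have hM2 : 2 * C / ε ≤ M := le_max_left _ _
      calc C * (1 / K) ^ θ ≤ C * (1 / M) := by gcongr
        _ = C / M := by ring
        _ ≤ C / (2 * C / ε) := by
            apply div_le_div_of_nonneg_left hC.le (by positivity) hM2
        _ = ε / 2 := by field_simp
  have hev1 := h1 R (ε / 2) (by positivity) K hKpos
  -- eventually δ ≤ (√3/2)/K and 0 < δ
  have hsmall : ∀ᶠ δ in nhdsWithin (0 : ℝ) (Set.Ioi 0), δ ≤ Real.sqrt 3 / 2 / K := by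
    have : Set.Iio (Real.sqrt 3 / 2 / K) ∈ nhds (0 : ℝ) := by
      apply Iio_mem_nhds; positivity
    filter_upwards [nhdsWithin_le_nhds this] with δ hδ using (Set.mem_Iio.1 hδ).le
  have hpos : ∀ᶠ δ in nhdsWithin (0 : ℝ) (Set.Ioi 0), 0 < δ :=
    eventually_mem_nhdsWithin.mono fun δ hδ => Set.mem_Ioi.1 hδ
  filter_upwards [hev1, hev2, hsmall, hpos] with δ h1δ h2δ h3δ h4δ
  set t : ℝ := K * δ with ht
  have htpos : 0 < t := mul_pos hKpos h4δ
  have hp0 : 0 ≤ t / (1 + t) := by positivity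
  have hp1 : t / (1 + t) ≤ K * δ := by
    rw [div_le_iff₀ (by positivity), ht]
    nlinarith [mul_pos hKpos h4δ]
  have hA := h1δ (t / (1 + t)) hp0 hp1
  have htlo : c₀ * δ ≤ t := by rw [ht]; exact mul_le_mul_of_nonneg_right hc₀le h4δ.le
  have hthi : t ≤ Real.sqrt 3 / 2 := by
    rw [ht]; rw [le_div_iff₀ hKpos] at h3δ; linarith
  have hB := h2δ t htlo hthi
  have hδt : δ / t = 1 / K := by
    rw [ht]; field_simp
  rw [hδt] at hB
  have hB' : |gaugeCrossingProb ((Real.sqrt 3 / 2) / (1 + Real.sqrt 3 / 2)) R δ -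
      gaugeCrossingProb (t / (1 + t)) R δ| ≤ ε / 2 := hB.trans hCK
  calc |gaugeCrossingProb ((Real.sqrt 3 / 2) / (1 + Real.sqrt 3 / 2)) R δ - gaugeCrossingProb 0 R δ|
      ≤ |gaugeCrossingProb ((Real.sqrt 3 / 2) / (1 + Real.sqrt 3 / 2)) R δ -
            gaugeCrossingProb (t / (1 + t)) R δ| +
          |gaugeCrossingProb (t / (1 + t)) R δ - gaugeCrossingProb 0 R δ| := abs_sub_le _ _ _
    _ ≤ ε / 2 + ε / 2 := add_le_add hB' hA
    _ = ε := by ring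

end Summit.CriticalPhenomena.CardyFormulaZ2.Cruxes.CornerLineDescent.IdeatorOne
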